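import Literature.AlgebraicGeometry.Motives.HodgeStructureOfCMType
import Literature.AlgebraicGeometry.Motives.GenericMumfordTateTypeStability
import HarnessLib

/-!
# The eigen-basis of `V_ℂ = ℂ ⊗ K` for the Hodge structure of a CM type, and its grading operator

For a number field `K` and a CM type `Φ` of `K`, the weight-one Hodge structure `V¹_{(K,Φ)}` on
`V = K` is `HodgeStructure.ofCMType Φ` (`Motives/HodgeStructureOfCMType`).  This file fixes the
**eigen-basis** `e_σ`, `σ ∈ Hom(K, ℂ)`, of `V_ℂ = ℂ ⊗_ℚ K ≅ ℂ^{Hom(K,ℂ)}` (the basis dual to the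
coordinates `embCoords`, [GreenGriffithsKerr2012] §V.C "the corresponding basis `ω = {ω_θ}` … is an
eigenbasis for the regular representation of `F` on itself") and PROVES that it is a GRADED basis
adapted to `V¹_{(K,Φ)}` in the sense of the tree's Mumford–Tate files
(`Motives/MumfordTateInvariantsHodgeBasis`, `…LieStabilizer`): with `deg σ = 1` on `Φ` and `0` off `Φ`,

* `ofCMType_F_eq_span` : `F^p = span {e_σ | p ≤ deg σ}`,
* `complexConj_ofCMType_F_eq_span` : `conj F^p = span {e_σ | deg σ ≤ 1 - p}`,

so that every statement of those files about graded bases applies; in particular the **grading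
operator** `Θ_Φ = diag(𝟙_Φ)` (`gradingEnd (cmBasis K) (cmDeg Φ)`, Deligne's `dμ(1)`) lies in the
complexified Mumford–Tate Lie algebra (`gradingEnd_cmBasis_mem_span_mumfordTateLieAlgebra`, from the
tree's `gradingEnd_mem_span_lieStabilizer`).  Also recorded: multiplication by `x ∈ K` is DIAGONAL in
this basis with eigenvalues `σ(x)` (`lmul_baseChange_cmBasis`), `1 ⊗ y = Σ_σ σ(y) e_σ`
(`one_tmul_eq_sum_cmBasis`), and the complexified trace functional `Tr(y · –)` is `Σ_σ σ(y) e_σ^∨`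
(`traceForm_baseChange_cmBasis`).  These are the inputs of the computation `dim MT(V¹_{(K,Φ)}) = rank Φ`
(Deligne 1982 Ex. 3.7 (c); files `Motives/CMTypeTensorCoordinates`, `Motives/MumfordTateRankOfCMType`).

Everything here is a theorem or a definition with a body; no named fact is introduced (net debt `0`).

## Sources

* P. Deligne, *Hodge cycles on abelian varieties* (notes by J. S. Milne), LNM 900 (1982)
  [Deligne1982HodgeCycles], I §3 (proof of Prop. 3.4: `μ(𝔾ₘ)` acts on `V^{p,q}` through `p`) and
  Example 3.7 ("`H₁(A) ⊗ ℂ ≃ E ⊗_ℚ ℂ → ℂ^S = ℂ^Σ ⊕ ℂ^{ιΣ}`, `u ⊗ 1 ↦ (σu)_{σ ∈ S}`").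
* M. Green, P. Griffiths, M. Kerr, *Mumford–Tate Groups and Domains* (2012) [GreenGriffithsKerr2012],
  §V.C ("`[η(f)]_ω = diag{θ₁(f), …, θ_r(f)}`").

## Provenance

Cell `pub-hodgecm2` (COR-CM), literature infrastructure row INFRA-03-2 of `LIT-FANOUT-PLAN` §B-v5 (R11),
seat `pub-hodgecm2-b16` (gen 11).
-/

noncomputable section

open scoped TensorProduct
open Module

namespace Literature.AlgebraicGeometry.Motives

namespace HodgeStructure

open RealMult (embCoords embCoords_tmul)

variable {K : Type} [Field K] [NumberField K]

/-! ### The eigen-basis `e_σ` of `V_ℂ = ℂ ⊗ K` -/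

variable (K) in
/-- **The eigen-basis of `V_ℂ = ℂ ⊗_ℚ K`**: `e_σ`, `σ ∈ Hom(K, ℂ)`, the basis corresponding to the
standard basis of `ℂ^{Hom(K,ℂ)}` under the coordinates `embCoords : ℂ ⊗ K ≃ ℂ^{Hom(K,ℂ)}`,
`z ⊗ y ↦ (z σ(y))_σ` — the eigenbasis `{ω_θ}` of the regular representation of
[GreenGriffithsKerr2012] §V.C. [cite: GreenGriffithsKerr2012, §V.C] -/
def cmBasis : Module.Basis (K →+* ℂ) ℂ (ℂ ⊗[ℚ] K) :=
  (Pi.basisFun ℂ (K →+* ℂ)).map (embCoords K).symm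

open scoped Classical in
/-- `e_σ` is the vector with coordinates `δ_σ`. [cite: GreenGriffithsKerr2012, §V.C] -/
theorem cmBasis_apply (σ : K →+* ℂ) : cmBasis K σ = (embCoords K).symm (Pi.single σ 1) := by
  simp [cmBasis]

open scoped Classical in
/-- The coordinates of `e_σ`: `(e_σ)_τ = δ_{στ}`. [cite: GreenGriffithsKerr2012, §V.C] -/
theorem embCoords_cmBasis (σ τ : K →+* ℂ) :
    embCoords K (cmBasis K σ) τ = if τ = σ then 1 else 0 := by
  rw [cmBasis_apply, LinearEquiv.apply_symm_apply, Pi.single_apply]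

/-- The coordinates in the eigen-basis ARE the coordinates `embCoords`. [cite: GreenGriffithsKerr2012, §V.C] -/
theorem cmBasis_repr (w : ℂ ⊗[ℚ] K) (σ : K →+* ℂ) : (cmBasis K).repr w σ = embCoords K w σ := by
  simp [cmBasis]

/-- **`1 ⊗ y = Σ_σ σ(y) e_σ`** (Deligne: "`u ⊗ 1 ↦ (σu)_{σ ∈ S}`"). [cite: Deligne1982HodgeCycles, I Ex. 3.7] -/
theorem one_tmul_eq_sum_cmBasis (y : K) :
    ((1 : ℂ) ⊗ₜ[ℚ] y : ℂ ⊗[ℚ] K) = ∑ σ : K →+* ℂ, (σ y) • cmBasis K σ := by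
  conv_lhs => rw [← (cmBasis K).sum_repr ((1 : ℂ) ⊗ₜ[ℚ] y)]
  refine Finset.sum_congr rfl fun σ _ => ?_
  rw [cmBasis_repr, embCoords_tmul, one_mul]

/-- **Multiplication by `x ∈ K` is diagonal in the eigen-basis, with eigenvalues `σ(x)`**:
`(x · –)_ℂ e_σ = σ(x) e_σ` ("`[η(f)]_ω = diag{θ₁(f), …, θ_r(f)}`"). [cite: GreenGriffithsKerr2012, §V.C] -/
theorem lmul_baseChange_cmBasis (x : K) (σ : K →+* ℂ) :
    (Algebra.lmul ℚ K x : Module.End ℚ K).baseChange ℂ (cmBasis K σ) = σ x • cmBasis K σ := by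
  classical
  apply (embCoords K).injective
  funext τ
  rw [embCoords_lmul_baseChange, map_smul, Pi.smul_apply, smul_eq_mul, embCoords_cmBasis]
  split_ifs with h
  · rw [h]
  · rw [mul_zero, mul_zero]

/-- **The complexified trace functional in coordinates**: for `y ∈ K` the functional
`Tr_{K/ℚ}(y · –)` (Mathlib's `Algebra.traceForm ℚ K y`) extends to `w ↦ Σ_σ σ(y) w_σ` on `V_ℂ`
(`Tr = Σ_σ σ`; the trace pairing in the eigen-coordinates, [GreenGriffithsKerr2012] §V.D
"`Q(u, ū) = Tr(ζ u ū)`" computed coordinatewise). [cite: GreenGriffithsKerr2012, §V.D] -/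
theorem traceForm_baseChange_apply (y : K) (w : ℂ ⊗[ℚ] K) :
    Module.Dual.baseChange ℂ (Algebra.traceForm ℚ K y) w = ∑ σ : K →+* ℂ, σ y * embCoords K w σ := by
  induction w using TensorProduct.induction_on with
  | zero => simp
  | tmul z v =>
    rw [Module.Dual.baseChange_apply_tmul, Algebra.traceForm_apply, Algebra.smul_def,
      RealMult.algebraMap_trace_eq_sum, Finset.sum_mul]
    refine Finset.sum_congr rfl fun σ _ => ?_
    rw [embCoords_tmul, map_mul]
    ring
  | add w₁ w₂ h₁ h₂ =>
    simp only [map_add, h₁, h₂, Pi.add_apply, mul_add, Finset.sum_add_distrib]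

/-- `Tr(y · –)_ℂ (e_τ) = τ(y)`: in the dual basis `e^∨` the complexified trace functional of `y` is
`Σ_τ τ(y) e_τ^∨` (the trace pairing is diagonal in the eigen-coordinates). [cite: GreenGriffithsKerr2012, §V.D] -/
theorem traceForm_baseChange_cmBasis (y : K) (τ : K →+* ℂ) :
    Module.Dual.baseChange ℂ (Algebra.traceForm ℚ K y) (cmBasis K τ) = τ y := by
  classical
  rw [traceForm_baseChange_apply, Finset.sum_eq_single τ]
  · rw [embCoords_cmBasis, if_pos rfl, mul_one]
  · intro σ _ hσ
    rw [embCoords_cmBasis, if_neg hσ, mul_zero]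
  · intro h
    exact absurd (Finset.mem_univ τ) h

/-- Coordinate subspaces are spans of eigen-basis vectors: `⊕_{σ ∈ S} ℂ_σ = span {e_σ | σ ∈ S}`.
[cite: GreenGriffithsKerr2012, §V.C] -/
theorem coordSubspace_eq_span (S : Set (K →+* ℂ)) :
    coordSubspace K S = Submodule.span ℂ (cmBasis K '' S) := by
  ext w
  rw [mem_coordSubspace_iff, (cmBasis K).mem_span_image]
  constructor
  · intro h σ hσ
    rw [Finset.mem_coe, Finsupp.mem_support_iff, cmBasis_repr] at hσ
    by_contra hS
    exact hσ (h σ hS)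
  · intro h τ hτ
    by_contra hne
    exact hτ (h (by rw [Finset.mem_coe, Finsupp.mem_support_iff, cmBasis_repr]; exact hne))

/-! ### The eigen-basis is a graded basis for `V¹_{(K,Φ)}` -/

variable (Φ : CMType K)

open scoped Classical in
/-- The **degree function of a CM type** on the embeddings: `deg σ = 1` for `σ ∈ Φ` (type `(1,0)`),
`deg σ = 0` for `σ ∉ Φ` (type `(0,1)`) — the exponents of Deligne's cocharacter `μ_Φ = Σ_{σ ∈ Φ} e_σ`.
[cite: Deligne1982HodgeCycles, I Ex. 3.7] -/
def cmDeg (σ : K →+* ℂ) : ℤ := if σ ∈ Φ.1 then 1 else 0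

omit [NumberField K] in
/-- `deg σ = 1` on `Φ`. [cite: Deligne1982HodgeCycles, I Ex. 3.7] -/
theorem cmDeg_of_mem {σ : K →+* ℂ} (h : σ ∈ Φ.1) : cmDeg Φ σ = 1 := by
  classical
  simp [cmDeg, h]

omit [NumberField K] in
/-- `deg σ = 0` off `Φ`. [cite: Deligne1982HodgeCycles, I Ex. 3.7] -/
theorem cmDeg_of_notMem {σ : K →+* ℂ} (h : σ ∉ Φ.1) : cmDeg Φ σ = 0 := by
  classical
  simp [cmDeg, h]

omit [NumberField K] in
/-- `{σ | 1 ≤ deg σ} = Φ`. [cite: Deligne1982HodgeCycles, I Ex. 3.7] -/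
theorem setOf_one_le_cmDeg : {σ | (1 : ℤ) ≤ cmDeg Φ σ} = Φ.1 := by
  ext σ
  by_cases h : σ ∈ Φ.1
  · simp [cmDeg_of_mem Φ h, h]
  · simp [cmDeg_of_notMem Φ h, h]

omit [NumberField K] in
/-- `{σ | deg σ ≤ 0} = Φᶜ`. [cite: Deligne1982HodgeCycles, I Ex. 3.7] -/
theorem setOf_cmDeg_le_zero : {σ | cmDeg Φ σ ≤ 0} = Φ.1ᶜ := by
  ext σ
  by_cases h : σ ∈ Φ.1
  · simp [cmDeg_of_mem Φ h, h]
  · simp [cmDeg_of_notMem Φ h, h]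

omit [NumberField K] in
/-- `0 ≤ deg σ ≤ 1`. [cite: Deligne1982HodgeCycles, I Ex. 3.7] -/
theorem cmDeg_nonneg_le_one (σ : K →+* ℂ) : 0 ≤ cmDeg Φ σ ∧ cmDeg Φ σ ≤ 1 := by
  by_cases h : σ ∈ Φ.1
  · simp [cmDeg_of_mem Φ h]
  · simp [cmDeg_of_notMem Φ h]

/-- **The eigen-basis is adapted to the Hodge filtration of `V¹_{(K,Φ)}`**:
`F^p = span {e_σ | p ≤ deg σ}` (`F^p = V_ℂ` for `p ≤ 0`, `⊕_{σ ∈ Φ} ℂ_σ` for `p = 1`, `0` for `p ≥ 2`).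
[cite: Deligne1982HodgeCycles, I Ex. 3.7] [cite: GreenGriffithsKerr2012, §V.B] -/
theorem ofCMType_F_eq_span (p : ℤ) :
    (ofCMType Φ).F p = Submodule.span ℂ (cmBasis K '' {σ | p ≤ cmDeg Φ σ}) := by
  rw [ofCMType_F]
  by_cases hp : p ≤ 0
  · rw [twoStepFiltration_of_le_zero _ hp]
    have hset : {σ | p ≤ cmDeg Φ σ} = Set.univ :=
      Set.eq_univ_of_forall fun σ => le_trans hp (cmDeg_nonneg_le_one Φ σ).1
    rw [hset, Set.image_univ, (cmBasis K).span_eq]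
  by_cases hp1 : p ≤ 1
  · obtain rfl : p = 1 := le_antisymm hp1 (by omega)
    rw [twoStepFiltration_of_pos_of_le _ one_pos le_rfl, setOf_one_le_cmDeg, coordSubspace_eq_span]
  · rw [twoStepFiltration_of_lt _ (by omega) (by omega)]
    have hset : {σ | p ≤ cmDeg Φ σ} = ∅ :=
      Set.eq_empty_of_forall_notMem fun σ h => by
        have := (cmDeg_nonneg_le_one Φ σ).2
        simp only [Set.mem_setOf_eq] at h
        omega
    rw [hset, Set.image_empty, Submodule.span_empty]

/-- **… and to its complex conjugate**: `conj F^p = span {e_σ | deg σ ≤ 1 - p}` (`conj (⊕_{σ ∈ Φ} ℂ_σ) =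
⊕_{σ ∉ Φ} ℂ_σ` since `Φ̄ = Φᶜ`). [cite: Deligne1982HodgeCycles, I Ex. 3.7] [cite: GreenGriffithsKerr2012, §V.D] -/
theorem complexConj_ofCMType_F_eq_span (p : ℤ) :
    complexConj ((ofCMType Φ).F p) = Submodule.span ℂ (cmBasis K '' {σ | cmDeg Φ σ ≤ 1 - p}) := by
  rw [ofCMType_F]
  by_cases hp : p ≤ 0
  · rw [twoStepFiltration_of_le_zero _ hp, complexConj_top]
    have hset : {σ | cmDeg Φ σ ≤ 1 - p} = Set.univ :=
      Set.eq_univ_of_forall fun σ => le_trans (cmDeg_nonneg_le_one Φ σ).2 (by omega)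
    rw [hset, Set.image_univ, (cmBasis K).span_eq]
  by_cases hp1 : p ≤ 1
  · obtain rfl : p = 1 := le_antisymm hp1 (by omega)
    rw [twoStepFiltration_of_pos_of_le _ one_pos le_rfl, complexConj_coordSubspace,
      conjugate_preimage_cmType, show (1 : ℤ) - 1 = 0 by norm_num, setOf_cmDeg_le_zero,
      coordSubspace_eq_span]
  · rw [twoStepFiltration_of_lt _ (by omega) (by omega), complexConj_bot]
    have hset : {σ | cmDeg Φ σ ≤ 1 - p} = ∅ :=
      Set.eq_empty_of_forall_notMem fun σ h => by
        have := (cmDeg_nonneg_le_one Φ σ).1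
        simp only [Set.mem_setOf_eq] at h
        omega
    rw [hset, Set.image_empty, Submodule.span_empty]

/-! ### The grading operator `Θ_Φ` lies in the complexified Mumford–Tate Lie algebra -/

/-- **The grading operator of a CM type**, `Θ_Φ e_σ = deg σ • e_σ` (`= e_σ` on `Φ`, `= 0` off `Φ`):
Deligne's `dμ_Φ(1)`, the differential of the cocharacter `μ_Φ = Σ_{σ ∈ Φ} e_σ^∨` of the torus
`(K ⊗ ℂ)^× = (ℂ^×)^{Hom(K,ℂ)}` ("`μ(ℂ^×) ⊂ (E ⊗ ℂ)^×`"). [cite: Deligne1982HodgeCycles, I Ex. 3.7] -/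
theorem gradingEnd_cmBasis_apply (σ : K →+* ℂ) :
    gradingEnd (cmBasis K) (cmDeg Φ) (cmBasis K σ) = (cmDeg Φ σ : ℂ) • cmBasis K σ := by
  classical
  exact gradingEnd_apply_basis (cmBasis K) (cmDeg Φ) σ

/-- **`Θ_Φ ∈ 𝔪𝔱(V¹_{(K,Φ)})_ℂ`**: the grading operator of the CM type lies in the `ℂ`-span of the
complexifications of the Mumford–Tate Lie algebra `𝔪𝔱 = Lie MT` (`HodgeStructure.mumfordTateLieAlgebra`,
the annihilator of the rational tensors of weight `0` and type `(0,0)`) — "`G` is the smallest algebraic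
subgroup … such that `G(ℂ)` contains `μ(ℂ^×)`", infinitesimally; the tree's
`gradingEnd_mem_span_lieStabilizer` for the graded basis `e_σ`. [cite: Deligne1982HodgeCycles, I Ex. 3.7] -/
theorem gradingEnd_cmBasis_mem_span_mumfordTateLieAlgebra [HodgeTensorFacts.{0, 0}] :
    gradingEnd (cmBasis K) (cmDeg Φ) ∈ Submodule.span ℂ
      ((fun X : Module.End ℚ K => X.baseChange ℂ) ''
        ((ofCMType Φ).mumfordTateLieAlgebra : Set (Module.End ℚ K))) := by
  classical
  rw [mumfordTateLieAlgebra_eq_lieStabilizer]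
  exact gradingEnd_mem_span_lieStabilizer (ofCMType Φ) (cmBasis K) (ofCMType_F_eq_span Φ)
    (complexConj_ofCMType_F_eq_span Φ)

end HodgeStructure

end Literature.AlgebraicGeometry.Motives

end
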